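import Summits.SmoothPoincare4.SmoothPoincare4.Theorems.ConvexBisectionSteinBisectionExists
import Literature.Geometry.Symplectic.KahlerDecomposition

/-!
# `ConvexBisection.SteinBisectionExists` (item stmt-SmoothPoincare4-10509) from the named fact
# `Literature.Geometry.Symplectic.baykur_kahlerDecomposition`

The CONDITIONAL closure of the support item
`Summit.SmoothPoincare4.SmoothPoincare4.Theses.ConvexBisection.SteinBisectionExists` (every smooth
`M ≃ₕ S⁴` admits a Stein bisection along a common contact seam) on exactly one named fact of the
tree: Baykur's Kähler decomposition theorem (Algebr. Geom. Topol. 6 (2006), Thm. 5.1 — every closed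
oriented smooth 4-manifold is a gluing `W₁ ∪_ψ W₂` of two compact Stein domains whose complex
tangencies agree on the common contact boundary; `Literature/Geometry/Symplectic/KahlerDecomposition.lean`).
The reduction itself — with the fact's body spelled out as a hypothesis — and the equivalence
"item ⇔ every homotopy 4-sphere is such a contact twisted double" are in
`Theorems/ConvexBisectionSteinBisectionExists.lean`; this file only plugs the named fact in, so
that the item's trust base is the single name `baykur_kahlerDecomposition` (D-0014: CONDITIONAL
until `baykur_kahlerDecomposition_holds` is proved; then `steinBisectionExists_of_baykur ‹_›` closes
the item).
-/

noncomputable section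

-- the prescribed namespace `Summit.<P>.<Sub>.…` duplicates `SmoothPoincare4` (P = Sub)
set_option linter.dupNamespace false

namespace Summit.SmoothPoincare4.SmoothPoincare4.Theorems.SteinBisection

open Summit.SmoothPoincare4.SmoothPoincare4.Theses.ConvexBisection
open Literature.Geometry.Symplectic

/-- **`SteinBisectionExists` holds conditionally on Baykur's Kähler decomposition theorem**
(named fact `Literature.Geometry.Symplectic.baykur_kahlerDecomposition`, Baykur 2006, Thm. 5.1):
the fact is, verbatim, the hypothesis `hK` of `steinBisectionExists_of_kahlerDecomposition`.
[cite: Baykur2006, Thm. 5.1] -/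
theorem steinBisectionExists_of_baykur (h : baykur_kahlerDecomposition) : SteinBisectionExists :=
  steinBisectionExists_of_kahlerDecomposition h

end Summit.SmoothPoincare4.SmoothPoincare4.Theorems.SteinBisection

end
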